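import Mathlib
import Summits.CriticalPhenomena.SAWScalingLimit.Theorems.SAWDefectDecoherenceObservableToSLERGateTransferRootSide

/-!
# Gate transfer, sides 2: lower levels do not depend on the middle piece; one-sided transfer

Support file for the stub `stub_gateTransfer` (the gate transfer
`GateDecomposition → RenewalAccumulation → CarvedToSLE → HexTight → FullIdentification`) of the
line `bridge-gate-renewal` for the crux
`Summit.CriticalPhenomena.SAWScalingLimit.Theses.SAWDefectDecoherence.ObservableToSLER`
(item `stmt-CriticalPhenomena-14005`).

* `le_of_isGoodGate_of_prefix_eq` (the topological heart, part (β)) — if `w₀`, `w` share their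
  first `m` vertices, `(n; m, p, q)` is the first good gate of `w₀` and level `n` is good for `w`,
  then no level `n₂ < n` is good for `w`;
* `exists_walk_take`, `exists_walk_drop` — prefixes/suffixes of SAWs are SAWs;
* `isFirstGoodGate_of_prefix` (registered sub-goal `stub_firstGoodGateTransfer`) — one-sided
  transfer of the first good gate to every walk `l₁ ++ rest` with `rest` from `q` avoiding the
  root side;
* `gatePoint_mem_of_single_crossing` — a single-crossing gate is a genuine cross-cut.
-/

noncomputable section

open scoped BigOperators Topology NNReal ENNReal Classical BoundedContinuousFunction unitInterval
open Filter Set MeasureTheory Metric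

namespace Summit.CriticalPhenomena.SAWScalingLimit.Theorems.ObservableToSLER.BridgeGate

open Literature.Probability.LatticeModels (HexVertex hexGraph hexCenter triZeta Site polyline)
open Literature.Probability.RandomPlanarGeometry
open Literature.Probability.RandomPlanarGeometry.SAW
open Summit.CriticalPhenomena.SAWScalingLimit.Theorems.ObservableToSLE.Negative
  (mem_embMeshDomain_of_mem_support_tail)

section LowerLevels

variable (D : DobrushinDomain) {δ r R ρ : ℝ}

/-- **Lower levels do not depend on the middle piece** (topological heart, part (β)).  Let `w₀`
and `w` be walks of `Ω_δ` with the same endpoints and the same first `m` vertices, let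
`(n; m, p, q)` be the FIRST good gate of `w₀`, and suppose the level `n` is good for `w` too.
Then no level `n₂ < n` is good for `w`: a good lower level for `w` would have its first exit
inside the common prefix, hence be a first exit of `w₀` with the same clean window; it is not
good for `w₀`, so `w₀` returns to its root side `U₂` after the exit — either inside the common
prefix (then so does `w`), or in its middle/final piece, outside the root side `U` of level `n`;
in the latter case `U₂` reaches across the level-`n` cut, whose far side (with the cut) is
connected in `Ω ∖ cut₂` (the lower cut lies inside `U`), so `U₂` contains `δ c_q` and `w`
returns to `U₂` at `q`. -/
theorem le_of_isGoodGate_of_prefix_eq (hδ : 0 < δ) {c e : HexVertex} {n m : ℕ} {p q : HexVertex}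
    (w₀ w : (hexDomainGraph D.carrier δ).Walk c e)
    (hfg₀ : IsFirstGoodGate D.carrier δ r R ρ c w₀.support n m p q)
    (hz : ∃ z₁ z₂ : ℂ, z₁ ∈ frontier (contHex δ c n) ∧ z₁ ∉ D.carrier ∧
      z₂ ∈ frontier (contHex δ c n) ∧ z₂ ∉ D.carrier ∧ z₁ ≠ z₂)
    (hpre : w.support.take m = w₀.support.take m)
    (hgood : IsGoodGate D.carrier δ r R ρ c w.support n m p q)
    {n₂ m₂ : ℕ} {p₂ q₂ : HexVertex} (h₂ : IsGoodGate D.carrier δ r R ρ c w.support n₂ m₂ p₂ q₂) :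
    n ≤ n₂ := by
  by_contra hlt
  push Not at hlt
  set L := w.support with hL
  set L₀ := w₀.support with hL₀
  have hfe : IsFirstExit c n L m p q := hgood.2.2.1
  have hfe₂ : IsFirstExit c n₂ L m₂ p₂ q₂ := h₂.2.2.1
  have hsc : ∀ v ∈ L.drop m, v ∉ sideVerts D.carrier δ c n p q := hgood.2.2.2.1
  have hsc₂ : ∀ v ∈ L.drop m₂, v ∉ sideVerts D.carrier δ c n₂ p₂ q₂ := h₂.2.2.2.1
  have hq : L[m]? = some q := hfe.getElem?_eq
  have hqK : q ∉ hexBall c n := hfe.2.2.2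
  have hm := hfe.pos
  have hml := hfe.lt_length
  have hml₀ := hfg₀.1.2.2.1.lt_length
  have hm₂ := hfe₂.pos
  -- Step 1: the lower exit happens strictly inside the common prefix
  have hm₂m : m₂ ≤ m := by
    by_contra h
    push Not at h
    have : q ∈ L.take m₂ := List.mem_of_getElem? (by rw [List.getElem?_take, if_pos h]; exact hq)
    exact hqK (hexBall_mono hlt.le (hfe₂.2.2.1 q this))
  have hpL : p ∈ L.take m := List.mem_of_getElem? (i := m - 1)
    (by rw [List.getElem?_take, if_pos (by omega)]; exact hfe.getElem?_pred_eq)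
  have hm₂m' : m₂ < m := by
    refine hm₂m.lt_of_ne fun heq => ?_
    subst heq
    have hp₂ : p₂ = p := by
      have := hfe₂.1.symm.trans hfe.1; exact Option.some_inj.1 this
    have hq₂ : q₂ = q := by
      have := hfe₂.getElem?_eq.symm.trans hfe.getElem?_eq; exact Option.some_inj.1 this
    subst hp₂ hq₂
    have hp : p₂ ∈ hexBall c n₂ := hfe₂.2.2.1 p₂ hpL
    exact hqK (mem_hexBall_of_adj_of_lt hlt hp ((adj_hexDomainGraph_iff).1 (hfe₂.adj w)).1.1)
  -- Step 2: the lower first exit is a first exit of `w₀` as well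
  have htake : L₀.take m₂ = L.take m₂ := by
    rw [← min_eq_left hm₂m, ← List.take_take, ← hpre, List.take_take]
  have hidx : L₀[m₂]? = L[m₂]? := by
    have h1 : (L₀.take m)[m₂]? = L₀[m₂]? := by rw [List.getElem?_take, if_pos hm₂m']
    have h2 : (L.take m)[m₂]? = L[m₂]? := by rw [List.getElem?_take, if_pos hm₂m']
    rw [← h1, ← h2, hpre]
  have hfe₂₀ : IsFirstExit c n₂ L₀ m₂ p₂ q₂ := by
    refine ⟨by rw [htake]; exact hfe₂.1, by rw [List.head?_drop, hidx]; exact hfe₂.getElem?_eq,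
      by rw [htake]; exact hfe₂.2.2.1, hfe₂.2.2.2⟩
  -- Step 3: the level `n₂` is not good for `w₀`, so `w₀` returns to the root side `U₂`
  have hret : ∃ v ∈ L₀.drop m₂, v ∈ sideVerts D.carrier δ c n₂ p₂ q₂ := by
    by_contra hcon
    push Not at hcon
    exact absurd (hfg₀.2 n₂ m₂ p₂ q₂ ⟨h₂.1, h₂.2.1, hfe₂₀, hcon, h₂.2.2.2.2⟩) (not_le.2 hlt)
  obtain ⟨v, hv, hvS₂⟩ := hret
  -- vertices of the two walks
  have hnil := not_nil_of_isFirstExit w hfe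
  have hnil₀ := not_nil_of_isFirstExit w₀ hfg₀.1.2.2.1
  have hΩ : ∀ x ∈ L, (δ : ℂ) * hexCenter x ∈ D.carrier := fun x hx => mem_of_mem_support w hnil hx
  have hΩ₀ : ∀ x ∈ L₀, (δ : ℂ) * hexCenter x ∈ D.carrier := fun x hx => mem_of_mem_support w₀ hnil₀ hx
  have hqL : q ∈ L := List.mem_of_getElem? hq
  have hqdrop₂ : q ∈ L.drop m₂ := List.mem_iff_getElem?.2 ⟨m - m₂, by
    rw [List.getElem?_drop, Nat.add_sub_cancel' hm₂m]; exact hq⟩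
  have hqS₂ : q ∉ sideVerts D.carrier δ c n₂ p₂ q₂ := hsc₂ q hqdrop₂
  have hp₂L : p₂ ∈ L.take m := List.mem_of_getElem? (i := m₂ - 1)
    (by rw [List.getElem?_take, if_pos (by omega)]; exact hfe₂.getElem?_pred_eq)
  have hq₂L : q₂ ∈ L.take m := List.mem_of_getElem? (i := m₂)
    (by rw [List.getElem?_take, if_pos hm₂m']; exact hfe₂.getElem?_eq)
  have hp₂Ω : (δ : ℂ) * hexCenter p₂ ∈ D.carrier := hΩ p₂ (List.mem_of_mem_take hp₂L)
  -- notation for the two cuts and sides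
  set cut := gateCut D.carrier δ c n p q with hcut
  set cut₂ := gateCut D.carrier δ c n₂ p₂ q₂ with hcut₂
  have hcutK : cut ⊆ frontier (contHex δ c n) := (connectedComponentIn_subset _ _).trans inter_subset_left
  have hcut₂K : cut₂ ⊆ frontier (contHex δ c n₂) :=
    (connectedComponentIn_subset _ _).trans inter_subset_left
  have hcut₂O : cut₂ ⊆ openHex δ c n :=
    hcut₂K.trans ((isClosed_contHex δ c n₂).frontier_subset.trans (contHex_subset_openHex hlt))
  have hside₂ : sideVerts D.carrier δ c n₂ p₂ q₂ =
      {x | (δ : ℂ) * hexCenter x ∈ connectedComponentIn (D.carrier \ cut₂) ((δ : ℂ) * hexCenter p₂)} := rfl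
  apply hqS₂
  rw [hside₂]
  show (δ : ℂ) * hexCenter q ∈ connectedComponentIn (D.carrier \ cut₂) ((δ : ℂ) * hexCenter p₂)
  by_cases hg₂ : gatePoint δ p₂ q₂ ∈ frontier (contHex δ c n₂) ∩ D.carrier
  swap
  · -- Case A: degenerate lower gate point, `U₂ ⊇ Ω`
    rw [hcut₂, gateCut, connectedComponentIn_eq_empty hg₂, sdiff_empty]
    exact D.isConnected.isPreconnected.subset_connectedComponentIn hp₂Ω subset_rfl (hΩ q hqL)
  -- Case B: a genuine lower cut
  obtain ⟨z₁, z₂, hz₁, hz₁D, hz₂, hz₂D, hne⟩ := hz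
  have hKc := convex_contHex δ c n
  have hKi := interior_contHex_nonempty hδ c n
  have hKb : Bornology.IsBounded (contHex δ c n) :=
    isBounded_closedBall.subset (contHex_subset_closedBall hδ c n)
  -- the level-`n` gate point is genuine too (else `q` would lie in the root side `U = Ω`)
  have hg : gatePoint δ p q ∈ frontier (contHex δ c n) ∩ D.carrier := by
    by_contra hg
    apply hsc q (List.mem_iff_getElem?.2 ⟨0, by rw [List.getElem?_drop, Nat.add_zero]; exact hq⟩)
    show (δ : ℂ) * hexCenter q ∈ connectedComponentIn (D.carrier \ cut) ((δ : ℂ) * hexCenter p)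
    rw [hcut, gateCut, connectedComponentIn_eq_empty hg, sdiff_empty]
    exact D.isConnected.isPreconnected.subset_connectedComponentIn
      (hΩ p (List.mem_of_mem_take hpL)) subset_rfl (hΩ q hqL)
  -- (i) `p₂`, `q₂` lie in the level-`n` root side `U`
  have hpref := take_subset_sideVerts D hδ ⟨z₁, z₂, hz₁, hz₁D, hz₂, hz₂D, hne⟩ w hfe
  have hp₂U : (δ : ℂ) * hexCenter p₂ ∈ connectedComponentIn (D.carrier \ cut) ((δ : ℂ) * hexCenter p) :=
    hpref p₂ hp₂L
  have hp₂O : (δ : ℂ) * hexCenter p₂ ∈ openHex δ c n := hexCenter_mem_openHex hδ (hfe.2.2.1 p₂ hp₂L)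
  have hq₂O : (δ : ℂ) * hexCenter q₂ ∈ openHex δ c n := hexCenter_mem_openHex hδ (hfe.2.2.1 q₂ hq₂L)
  -- (ii) the lower gate point lies in `U`
  have hσ : segment ℝ ((δ : ℂ) * hexCenter p₂) ((δ : ℂ) * hexCenter q₂) ⊆ closure D.carrier :=
    ((adj_hexDomainGraph_iff).1 (hfe₂.adj w)).1.2
  have hg₂σ := gatePoint_mem_segment δ p₂ q₂
  have hg₂O : gatePoint δ p₂ q₂ ∈ openHex δ c n := (convex_openHex δ c n).segment_subset hp₂O hq₂O hg₂σ
  have hg₂U : gatePoint δ p₂ q₂ ∈ connectedComponentIn (D.carrier \ cut) ((δ : ℂ) * hexCenter p) := by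
    have h := mem_connectedComponentIn_of_segment D.toJordanDomain hKc hKi hKb hg.1 hg.2 hz₁ hz₁D hz₂
      hz₂D hne hcut hp₂Ω hg₂.2 (openHex_subset_interior hp₂O) (openHex_subset_interior hg₂O)
      (((convex_segment _ _).segment_subset (left_mem_segment ℝ _ _) hg₂σ).trans hσ)
    rwa [← connectedComponentIn_eq hp₂U] at h
  -- (iii) the lower cut lies in `U`
  have hcut₂U : cut₂ ⊆ connectedComponentIn (D.carrier \ cut) ((δ : ℂ) * hexCenter p) := by
    rw [connectedComponentIn_eq hg₂U]
    refine isPreconnected_connectedComponentIn.subset_connectedComponentIn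
      (mem_connectedComponentIn hg₂) fun z hz => ⟨(connectedComponentIn_subset _ _ hz).2,
        fun hzc => not_mem_frontier_of_mem_openHex (hcut₂O hz) (hcutK hzc)⟩
  -- (iv) the far side `V` of `q` at level `n`, with the cut, is connected and misses `cut₂`
  set V := connectedComponentIn (D.carrier \ cut) ((δ : ℂ) * hexCenter q) with hV
  have hqcut : (δ : ℂ) * hexCenter q ∈ D.carrier \ cut :=
    ⟨hΩ q hqL, fun h => hexCenter_not_mem_frontier hδ q (hcutK h)⟩
  have hqU : (δ : ℂ) * hexCenter q ∉ connectedComponentIn (D.carrier \ cut) ((δ : ℂ) * hexCenter p) :=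
    hsc q (List.mem_iff_getElem?.2 ⟨0, by rw [List.getElem?_drop, Nat.add_zero]; exact hq⟩)
  have hVU : ∀ z ∈ V, z ∉ connectedComponentIn (D.carrier \ cut) ((δ : ℂ) * hexCenter p) := by
    intro z hzV hzU
    apply hqU
    rw [connectedComponentIn_eq hzU, ← connectedComponentIn_eq hzV]
    exact mem_connectedComponentIn hqcut
  have hcutV : cut ⊆ closure V :=
    cut_subset_closure_connectedComponentIn D.toJordanDomain hKc hKi hKb hg.1 hg.2 hz₁ hz₁D hz₂ hz₂D
      hne hcut hqcut
  have hVpre : IsPreconnected (V ∪ cut) :=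
    isPreconnected_connectedComponentIn.subset_closure subset_union_left
      (union_subset subset_closure hcutV)
  have hVsub : V ∪ cut ⊆ D.carrier \ cut₂ := by
    rintro z (hz | hz)
    · exact ⟨(connectedComponentIn_subset _ _ hz).1, fun h => hVU z hz (hcut₂U h)⟩
    · exact ⟨(connectedComponentIn_subset _ _ hz).2,
        fun h => not_mem_frontier_of_mem_openHex (hcut₂O h) (hcutK hz)⟩
  -- (v) where does `w₀` return to `U₂`?
  have hsplit : L₀.drop m₂ = (L₀.take m).drop m₂ ++ L₀.drop m := by
    conv_lhs => rw [← List.take_append_drop m L₀]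
    rw [List.drop_append_of_le_length (by rw [List.length_take]; omega)]
  rw [hsplit, List.mem_append] at hv
  rcases hv with hv | hv
  · -- inside the common prefix: `w` returns too
    rw [← hpre] at hv
    exact absurd hvS₂ (hsc₂ v (by
      have : L.drop m₂ = (L.take m).drop m₂ ++ L.drop m := by
        conv_lhs => rw [← List.take_append_drop m L]
        rw [List.drop_append_of_le_length (by rw [List.length_take]; omega)]
      rw [this]; exact List.mem_append_left _ hv))
  · -- after the level-`n` gate: `v ∉ U`, so `U₂` reaches across the level-`n` cut
    have hvU : (δ : ℂ) * hexCenter v ∉ connectedComponentIn (D.carrier \ cut) ((δ : ℂ) * hexCenter p) :=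
      hfg₀.1.2.2.2.1 v hv
    have hvΩ : (δ : ℂ) * hexCenter v ∈ D.carrier := hΩ₀ v (List.mem_of_mem_drop hv)
    have hp₂mem : (δ : ℂ) * hexCenter p₂ ∈ connectedComponentIn (D.carrier \ cut₂) ((δ : ℂ) * hexCenter p₂) :=
      mem_connectedComponentIn ⟨hp₂Ω, fun h => hexCenter_not_mem_frontier hδ p₂ (hcut₂K h)⟩
    -- `U₂` meets the level-`n` cut
    obtain ⟨z, hzU₂, hzcut⟩ : ∃ z ∈ connectedComponentIn (D.carrier \ cut₂) ((δ : ℂ) * hexCenter p₂),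
        z ∈ cut := by
      by_contra hcon
      push Not at hcon
      have hsub : connectedComponentIn (D.carrier \ cut₂) ((δ : ℂ) * hexCenter p₂) ⊆
          connectedComponentIn (D.carrier \ cut) ((δ : ℂ) * hexCenter p) := by
        rw [connectedComponentIn_eq hp₂U]
        exact isPreconnected_connectedComponentIn.subset_connectedComponentIn hp₂mem
          fun z hz => ⟨(connectedComponentIn_subset _ _ hz).1, hcon z hz⟩
      exact hvU (hsub hvS₂)
    -- hence `V ∪ cut ⊆ U₂`, and `δ c_q ∈ V`
    have hVU₂ : V ∪ cut ⊆ connectedComponentIn (D.carrier \ cut₂) ((δ : ℂ) * hexCenter p₂) := by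
      rw [connectedComponentIn_eq hzU₂]
      exact hVpre.subset_connectedComponentIn (Or.inr hzcut) hVsub
    exact hVU₂ (Or.inl (mem_connectedComponentIn hqcut))

end LowerLevels

section OneSided

variable (D : DobrushinDomain) {Ω : Set ℂ} {δ r R ρ : ℝ}

/-- A prefix of a self-avoiding walk is a self-avoiding walk. -/
theorem exists_walk_take {c e : HexVertex} (w : (hexDomainGraph Ω δ).Walk c e) (hw : w.IsPath)
    {m : ℕ} {p : HexVertex} (hm : (w.support.take m).getLast? = some p) :
    ∃ w₁ : (hexDomainGraph Ω δ).Walk c p, w₁.IsPath ∧ w₁.support = w.support.take m := by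
  have hne : w.support.take m ≠ [] := by rintro h; rw [h] at hm; simp at hm
  have hhead : (w.support.take m).head hne = c := by rw [List.head_take, w.head_support]
  have hlast : (w.support.take m).getLast hne = p := by
    rw [List.getLast?_eq_some_getLast hne, Option.some_inj] at hm; exact hm
  refine ⟨(SimpleGraph.Walk.ofSupport _ hne (w.isChain_adj_support.take m)).copy hhead hlast, ?_, ?_⟩
  · rw [SimpleGraph.Walk.isPath_copy, SimpleGraph.Walk.isPath_def, SimpleGraph.Walk.support_ofSupport]
    exact hw.support_nodup.sublist (List.take_sublist m _)
  · rw [SimpleGraph.Walk.support_copy, SimpleGraph.Walk.support_ofSupport]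

/-- A suffix of a self-avoiding walk is a self-avoiding walk. -/
theorem exists_walk_drop {c e : HexVertex} (w : (hexDomainGraph Ω δ).Walk c e) (hw : w.IsPath)
    {k : ℕ} {p' : HexVertex} (hk : (w.support.drop k).head? = some p') :
    ∃ w₂ : (hexDomainGraph Ω δ).Walk p' e, w₂.IsPath ∧ w₂.support = w.support.drop k := by
  have hne : w.support.drop k ≠ [] := by rintro h; rw [h] at hk; simp at hk
  have hhead : (w.support.drop k).head hne = p' := by
    rw [List.head?_eq_some_head hne, Option.some_inj] at hk; exact hk
  have hlast : (w.support.drop k).getLast hne = e := by rw [List.getLast_drop, w.getLast_support]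
  refine ⟨(SimpleGraph.Walk.ofSupport _ hne (w.isChain_adj_support.drop k)).copy hhead hlast, ?_, ?_⟩
  · rw [SimpleGraph.Walk.isPath_copy, SimpleGraph.Walk.isPath_def, SimpleGraph.Walk.support_ofSupport]
    exact hw.support_nodup.sublist (List.drop_sublist k _)
  · rw [SimpleGraph.Walk.support_copy, SimpleGraph.Walk.support_ofSupport]

/-- **One-sided transfer of the first good gate.**  If `w₀` has first good gate `(n; m, p, q)`
with prefix `l₁` (its first `m` vertices), and `w` is a walk with the same endpoints whose
support is `l₁ ++ rest` with `rest` starting at `q` and avoiding the root side, then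
`(n; m, p, q)` is the first good gate of `w` as well. -/
theorem isFirstGoodGate_of_prefix (hδ : 0 < δ) {c e : HexVertex} {n m : ℕ} {p q : HexVertex}
    (w₀ w : (hexDomainGraph D.carrier δ).Walk c e)
    (hfg₀ : IsFirstGoodGate D.carrier δ r R ρ c w₀.support n m p q)
    (hz : ∃ z₁ z₂ : ℂ, z₁ ∈ frontier (contHex δ c n) ∧ z₁ ∉ D.carrier ∧
      z₂ ∈ frontier (contHex δ c n) ∧ z₂ ∉ D.carrier ∧ z₁ ≠ z₂)
    {rest : List HexVertex} (hsupp : w.support = w₀.support.take m ++ rest)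
    (hhead : rest.head? = some q) (havoid : ∀ v ∈ rest, v ∉ sideVerts D.carrier δ c n p q) :
    IsFirstGoodGate D.carrier δ r R ρ c w.support n m p q := by
  have hfe₀ := hfg₀.1.2.2.1
  have hml₀ := hfe₀.lt_length
  have hlen : (w₀.support.take m).length = m := by rw [List.length_take]; exact min_eq_left hml₀.le
  have htake : w.support.take m = w₀.support.take m := by
    rw [hsupp, List.take_append_of_le_length hlen.ge, List.take_of_length_le hlen.le]
  have hdrop : w.support.drop m = rest := by
    rw [hsupp, List.drop_append_of_le_length hlen.ge, List.drop_of_length_le hlen.le, List.nil_append]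
  have hgood : IsGoodGate D.carrier δ r R ρ c w.support n m p q := by
    refine ⟨hfg₀.1.1, hfg₀.1.2.1, ⟨?_, ?_, ?_, hfe₀.2.2.2⟩, ?_, hfg₀.1.2.2.2.2⟩
    · rw [htake]; exact hfe₀.1
    · rw [hdrop]; exact hhead
    · rw [htake]; exact hfe₀.2.2.1
    · rw [hdrop]; exact havoid
  exact ⟨hgood, fun n₂ m₂ p₂ q₂ h₂ => le_of_isGoodGate_of_prefix_eq D hδ w₀ w hfg₀ hz htake hgood h₂⟩

/-- Membership in the last `m'` vertices in terms of the reversed list. -/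
theorem mem_drop_length_sub_iff {L : List HexVertex} {m' : ℕ} {v : HexVertex} :
    v ∈ L.drop (L.length - m') ↔ v ∈ L.reverse.take m' := by
  rw [List.take_reverse, List.mem_reverse]

end OneSided

section Genuine

variable {Ω : Set ℂ} {δ : ℝ}

/-- **A gate with the single-crossing property is a genuine crosscut**: its gate point lies on
the hexagon frontier inside `Ω` (otherwise the cut is empty, the root side is all of `Ω`, and
the walk is in it right after the gate). -/
theorem gatePoint_mem_of_single_crossing (hΩ : IsConnected Ω) {c e : HexVertex} {n m : ℕ}
    {p q : HexVertex} (w : (hexDomainGraph Ω δ).Walk c e) (hfe : IsFirstExit c n w.support m p q)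
    (hsc : ∀ v ∈ w.support.drop m, v ∉ sideVerts Ω δ c n p q) :
    gatePoint δ p q ∈ frontier (contHex δ c n) ∩ Ω := by
  by_contra hg
  have hnil := not_nil_of_isFirstExit w hfe
  have hq := hfe.getElem?_eq
  have hpL : p ∈ w.support := hfe.fst_mem
  apply hsc q hfe.snd_mem_drop
  show (δ : ℂ) * hexCenter q ∈ connectedComponentIn (Ω \ gateCut Ω δ c n p q) ((δ : ℂ) * hexCenter p)
  rw [gateCut, connectedComponentIn_eq_empty hg, sdiff_empty]
  exact hΩ.isPreconnected.subset_connectedComponentIn (mem_of_mem_support w hnil hpL) subset_rfl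
    (mem_of_mem_support w hnil (List.mem_of_getElem? hq))

end Genuine

end Summit.CriticalPhenomena.SAWScalingLimit.Theorems.ObservableToSLER.BridgeGate

namespace Summit.CriticalPhenomena.SAWScalingLimit.Theorems.ObservableToSLER.BridgeGate

open Literature.Probability.LatticeModels (HexVertex hexGraph hexCenter triZeta Site)
open Literature.Probability.RandomPlanarGeometry
open Literature.Probability.RandomPlanarGeometry.SAW

/-- **Registered sub-goal `stub_firstGoodGateTransfer`** (self-contained form of `isFirstGoodGate_of_prefix`). -/
theorem stub_firstGoodGateTransfer : ∀ (D : DobrushinDomain) (δ r R ρ : ℝ) (c e : HexVertex) (n m : ℕ) (p q : HexVertex) (w₀ w : (hexDomainGraph D.carrier δ).Walk c e) (rest : List HexVertex), 0 < δ → IsFirstGoodGate D.carrier δ r R ρ c w₀.support n m p q → (∃ z₁ z₂ : ℂ, z₁ ∈ frontier (contHex δ c n) ∧ z₁ ∉ D.carrier ∧ z₂ ∈ frontier (contHex δ c n) ∧ z₂ ∉ D.carrier ∧ z₁ ≠ z₂) → w.support = w₀.support.take m ++ rest → rest.head? = some q → (∀ v ∈ rest, v ∉ sideVerts D.carrier δ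 c n p q) → IsFirstGoodGate D.carrier δ r R ρ c w.support n m p q :=
  fun D _ _ _ _ _ _ _ _ _ _ w₀ w _ hδ hfg₀ hz hsupp hhead havoid =>
    isFirstGoodGate_of_prefix D hδ w₀ w hfg₀ hz hsupp hhead havoid

end Summit.CriticalPhenomena.SAWScalingLimit.Theorems.ObservableToSLER.BridgeGate

end
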